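import Summits.HodgeConjecture.CorCM.TwoGroupCentraliserWords
import Summits.HodgeConjecture.CorCM.TwoGroupCaseACyclicEightNormalForm
import HarnessLib

/-!
# Case A of the order-`32` base: the eighteen raw bits of family CA2 (`C(t)/N ≅ C₂²`)

COR-CM (cell `pub-hodgecm2`), binder seat b04 (gen 37), count-neutral own lane «Galois-CM-type classification».  KERNEL ONLY:
theorems; no definition, no named fact, no `sorry`.  Pure group theory (A7-JUNCTION gen-36 addendum §G (b), gen-37 addendum).
`|G| = 32`, `c ≠ 1` a central involution; `t ∉ {1, c}` an involution with `x t x⁻¹ = tc` and all conjugates in `{t, tc}`; every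
element of `M = C(t)` squares into `N = {1, t, c, tc}`; `a ∈ M ∖ N`, `b ∈ M ∖ N⟨a⟩`.  Then `M = N{1, a, b, ab}` and the eighteen
bits of `CorCM/TwoGroupCentraliserExtensionTable` exist: `a² = t^{α₁}c^{α₂}`, `b² = t^{β₁}c^{β₂}`, `ba = ab t^{γ₁}c^{γ₂}`,
`x a x⁻¹ = t^{p₁}c^{q₁}a^{e₁}b^{e₂}`, `x b x⁻¹ = t^{p₂}c^{q₂}a^{e₃}b^{e₄}`, `x² = t^{p₃}c^{q₃}a^{e₅}b^{e₆}` (`exists_raw_bits`).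

## References

* [Rotman1995] J. J. Rotman, *An Introduction to the Theory of Groups*, 4th ed., GTM 148, Ch. 5 and Ch. 7 (extensions).
-/

namespace Summit.HodgeConjecture.CorCM.GaloisModels.CaseA

open Summit.HodgeConjecture.CorCM.GaloisTableLaws (zmod2_cases)

variable {G : Type*} [Group G]

/-! ## §1 Bits from membership in `N` -/

/-- `m ∈ {1, t, c, tc}` ⟹ `m = tᵖ c^q` for some bits. [folklore] -/
theorem exists_bits_of_mem {t c m : G} (h : m = 1 ∨ m = t ∨ m = c ∨ m = t * c) :
    ∃ p q : ZMod 2, m = t ^ p.val * c ^ q.val := by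
  have hv1 : (1 : ZMod 2).val = 1 := rfl
  rcases h with rfl | rfl | rfl | rfl
  · exact ⟨0, 0, by rw [ZMod.val_zero, pow_zero, pow_zero, mul_one]⟩
  · exact ⟨1, 0, by rw [hv1, ZMod.val_zero, pow_one, pow_zero, mul_one]⟩
  · exact ⟨0, 1, by rw [hv1, ZMod.val_zero, pow_zero, pow_one, one_mul]⟩
  · exact ⟨1, 1, by rw [hv1, pow_one, pow_one]⟩

/-- A word `tᵖ c^q` in commuting involutions is its own inverse. [folklore] -/
theorem invol_word_sq {t c : G} (htt : t * t = 1) (hcc : c * c = 1) (htc : t * c = c * t) (p q : ZMod 2) :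
    t ^ p.val * c ^ q.val * (t ^ p.val * c ^ q.val) = 1 := by
  rw [invol_word_mul htt hcc htc, show (p + p).val = 0 by rcases zmod2_cases p with rfl | rfl <;> rfl,
    show (q + q).val = 0 by rcases zmod2_cases q with rfl | rfl <;> rfl, pow_zero, pow_zero, mul_one]

/-- The commutator bits: from `a² = n_a`, `b² = n_b`, `(ab)² = n` (all words in `t, c`, commuting with `a, b`):
`ba = ab (n_a n n_b)`. [folklore] -/
theorem comm_word_of_sq {a b t c : G} (htt : t * t = 1) (hcc : c * c = 1) (htc : t * c = c * t) (hat : a * t = t * a)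
    (hac : a * c = c * a) (hbt : b * t = t * b) (hbc : b * c = c * b) {α₁ α₂ β₁ β₂ ν₁ ν₂ : ZMod 2}
    (haa : a * a = t ^ α₁.val * c ^ α₂.val) (hbb : b * b = t ^ β₁.val * c ^ β₂.val)
    (hab : a * b * (a * b) = t ^ ν₁.val * c ^ ν₂.val) :
    b * a = a * b * (t ^ (α₁ + ν₁ + β₁).val * c ^ (α₂ + ν₂ + β₂).val) := by
  -- words in `t, c` commute with `a` and `b`
  have hwa : ∀ p q : ZMod 2, t ^ p.val * c ^ q.val * a = a * (t ^ p.val * c ^ q.val) := fun p q =>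
    (((show Commute t a from hat.symm).pow_left _).mul_left ((show Commute c a from hac.symm).pow_left _)).eq
  have hwb : ∀ p q : ZMod 2, t ^ p.val * c ^ q.val * b = b * (t ^ p.val * c ^ q.val) := fun p q =>
    (((show Commute t b from hbt.symm).pow_left _).mul_left ((show Commute c b from hbc.symm).pow_left _)).eq
  -- `a⁻¹ = a n_a`, `b⁻¹ = n_b b`
  have hainv : a⁻¹ = a * (t ^ α₁.val * c ^ α₂.val) := by
    rw [inv_eq_iff_mul_eq_one, ← mul_assoc, haa, invol_word_sq htt hcc htc]
  have hbinv : b⁻¹ = t ^ β₁.val * c ^ β₂.val * b := by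
    rw [inv_eq_iff_mul_eq_one, hwb, ← mul_assoc, hbb, invol_word_sq htt hcc htc]
  -- `ba = a⁻¹ (abab) b⁻¹`
  have h1 : b * a = a⁻¹ * (a * b * (a * b)) * b⁻¹ := by group
  rw [h1, hab, hainv, hbinv]
  calc a * (t ^ α₁.val * c ^ α₂.val) * (t ^ ν₁.val * c ^ ν₂.val) * (t ^ β₁.val * c ^ β₂.val * b)
      = a * ((t ^ α₁.val * c ^ α₂.val) * (t ^ ν₁.val * c ^ ν₂.val) * ((t ^ β₁.val * c ^ β₂.val) * b)) := by group
    _ = a * ((t ^ (α₁ + ν₁).val * c ^ (α₂ + ν₂).val) * (b * (t ^ β₁.val * c ^ β₂.val))) := by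
        rw [invol_word_mul htt hcc htc, hwb]
    _ = a * ((t ^ (α₁ + ν₁).val * c ^ (α₂ + ν₂).val) * b) * (t ^ β₁.val * c ^ β₂.val) := by group
    _ = a * (b * (t ^ (α₁ + ν₁).val * c ^ (α₂ + ν₂).val)) * (t ^ β₁.val * c ^ β₂.val) := by rw [hwb]
    _ = a * b * ((t ^ (α₁ + ν₁).val * c ^ (α₂ + ν₂).val) * (t ^ β₁.val * c ^ β₂.val)) := by group
    _ = a * b * (t ^ (α₁ + ν₁ + β₁).val * c ^ (α₂ + ν₂ + β₂).val) := by rw [invol_word_mul htt hcc htc]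

/-! ## §2 The raw bits -/

variable [Finite G]

/-- **The eighteen raw bits of family CA2.**  `|G| = 32`, `c ≠ 1` a central involution, `t ∉ {1, c}` an involution with
`x t x⁻¹ = tc` and all conjugates in `{t, tc}`, every element of `C(t)` squaring into `{1, t, c, tc}`, `a, b ∈ C(t)` with
`a ∉ ⟨t, c⟩`, `b ∉ ⟨t, c⟩⟨a⟩`.  Then the relations of `CorCM/TwoGroupCentraliserExtensionTable` hold for some eighteen bits.
[cite: Rotman1995, Ch. 5 and Ch. 7] -/
theorem exists_raw_bits (hcard : Nat.card G = 32) {t c x a b : G} (hcc : c * c = 1) (hc1 : c ≠ 1)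
    (hcen : ∀ g : G, c * g = g * c) (hxt : x * t * x⁻¹ = t * c)
    (hconj : ∀ g : G, g * t * g⁻¹ = t ∨ g * t * g⁻¹ = t * c) (htt : t * t = 1) (ht1 : t ≠ 1) (htne : t ≠ c)
    (hN2 : ∀ m : G, m * t = t * m → m * m = 1 ∨ m * m = t ∨ m * m = c ∨ m * m = t * c)
    (hat : a * t = t * a) (hbt : b * t = t * b) (ha : ∀ p q : ZMod 2, a ≠ t ^ p.val * c ^ q.val)
    (hb : ∀ p q i : ZMod 2, b ≠ t ^ p.val * (c ^ q.val * a ^ i.val)) :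
    ∃ α₁ α₂ β₁ β₂ γ₁ γ₂ p₁ q₁ e₁ e₂ p₂ q₂ e₃ e₄ p₃ q₃ e₅ e₆ : ZMod 2,
      a * a = t ^ α₁.val * c ^ α₂.val ∧ b * b = t ^ β₁.val * c ^ β₂.val ∧
      b * a = a * b * (t ^ γ₁.val * c ^ γ₂.val) ∧
      x * a = t ^ p₁.val * c ^ q₁.val * a ^ e₁.val * b ^ e₂.val * x ∧
      x * b = t ^ p₂.val * c ^ q₂.val * a ^ e₃.val * b ^ e₄.val * x ∧
      x * x = t ^ p₃.val * c ^ q₃.val * a ^ e₅.val * b ^ e₆.val := by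
  classical
  obtain ⟨α₁, α₂, haa⟩ := exists_bits_of_mem (hN2 a hat)
  obtain ⟨β₁, β₂, hbb⟩ := exists_bits_of_mem (hN2 b hbt)
  obtain ⟨ν₁, ν₂, hab⟩ := exists_bits_of_mem (hN2 (a * b) (by rw [mul_assoc, hbt, ← mul_assoc, hat, mul_assoc]))
  have hba := comm_word_of_sq htt hcc (hcen t).symm hat (hcen a).symm hbt (hcen b).symm haa hbb hab
  have henum := exists_word_pair hcard hcc hc1 hcen hxt hconj htt ht1 htne hat hbt haa ha hb
  obtain ⟨p₁, q₁, e₁, e₂, h1⟩ := henum _ (conj_comm_of_comm (x := x) hcen hconj hat)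
  obtain ⟨p₂, q₂, e₃, e₄, h2⟩ := henum _ (conj_comm_of_comm (x := x) hcen hconj hbt)
  obtain ⟨p₃, q₃, e₅, e₆, h3⟩ := henum _ (sq_comm_of_conj hcc hcen hxt)
  refine ⟨α₁, α₂, β₁, β₂, α₁ + ν₁ + β₁, α₂ + ν₂ + β₂, p₁, q₁, e₁, e₂, p₂, q₂, e₃, e₄, p₃, q₃, e₅, e₆, haa, hbb, hba,
    ?_, ?_, h3⟩
  · rw [← h1]; group
  · rw [← h2]; group

/-! ## §3 Choosing the pair `a, b` -/

omit [Finite G] in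
/-- **`C(t) ∖ N⟨a⟩` is non-empty** (`|C(t)| = 16 > 8`): for any `a` there is `b ∈ C(t)` outside `{tᵖ c^q aⁱ}`. [folklore] -/
theorem exists_not_mem_coset (hcard : Nat.card G = 32) {t c x : G} (a : G) (hc1 : c ≠ 1) (hxt : x * t * x⁻¹ = t * c)
    (hconj : ∀ g : G, g * t * g⁻¹ = t ∨ g * t * g⁻¹ = t * c) :
    ∃ b : G, b * t = t * b ∧ ∀ p q i : ZMod 2, b ≠ t ^ p.val * (c ^ q.val * a ^ i.val) := by
  classical
  have hidx := index_centralizer_eq_two_of_conj hc1 hxt hconj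
  set C := Subgroup.centralizer ({t} : Set G) with hC
  have hC16 : Nat.card C = 16 := by
    have := C.card_mul_index; rw [hidx, hcard] at this; omega
  by_contra hall
  push Not at hall
  -- then `C ⊆` the image of the `8`-element type `𝔽₂³`
  let f : ZMod 2 × ZMod 2 × ZMod 2 → G := fun P => t ^ P.1.val * (c ^ P.2.1.val * a ^ P.2.2.val)
  have hsurj : ∀ m : C, ∃ P, f P = m := by
    rintro ⟨m, hm⟩
    obtain ⟨p, q, i, h⟩ := hall m (Subgroup.mem_centralizer_singleton_iff.1 hm)
    exact ⟨(p, q, i), h.symm⟩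
  have hle : Nat.card C ≤ Nat.card (ZMod 2 × ZMod 2 × ZMod 2) := by
    let g : C → ZMod 2 × ZMod 2 × ZMod 2 := fun m => (hsurj m).choose
    refine Nat.card_le_card_of_injective g fun m m' h => ?_
    have h1 := (hsurj m).choose_spec
    have h2 := (hsurj m').choose_spec
    exact Subtype.ext (h1.symm.trans ((congrArg f h).trans h2))
  simp only [Nat.card_prod, Nat.card_zmod] at hle
  omega

omit [Finite G] in
/-- Some `a ∈ C(t)` lies outside `N = {tᵖ c^q}`. [folklore] -/
theorem exists_not_mem_N (hcard : Nat.card G = 32) {t c x : G} (hc1 : c ≠ 1) (hxt : x * t * x⁻¹ = t * c)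
    (hconj : ∀ g : G, g * t * g⁻¹ = t ∨ g * t * g⁻¹ = t * c) :
    ∃ a : G, a * t = t * a ∧ ∀ p q : ZMod 2, a ≠ t ^ p.val * c ^ q.val := by
  -- apply the previous lemma with `a = 1`
  obtain ⟨b, hbt, hb⟩ := exists_not_mem_coset hcard 1 hc1 hxt hconj
  exact ⟨b, hbt, fun p q h => hb p q 0 (by rw [ZMod.val_zero, pow_zero, mul_one]; exact h)⟩

end Summit.HodgeConjecture.CorCM.GaloisModels.CaseA
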